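import Summits.Parity.GeneralizedHardyLittlewood.Theorems.LeeYangFibresRelativeDimOnePairRigidityWeightedTools
import Summits.Parity.GeneralizedHardyLittlewood.Theorems.LeeYangFibresRelativeDimOnePairRigidityDecayMain
import HarnessLib

/-!
# Reshaped pair-slice rigidity, WEIGHTED form — part 2, MAIN TERM and TAIL

Context (seat c1, crux stmt-Parity-14113, line `gallagher-backwards-split`): the registered `stub_rigidity` is FALSE
(`Cruxes/RelativeDimOne/StubRigidityFalse-c1.md`); the reshaped pair-slice rigidity `pairRigidityWithDecay` (decay
`C/φ(d)`) is landed in `…PairRigidityDecay*.lean`.  The reshaped PAIR line needs the decay measured by a general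
Hardy–Littlewood weight `ρ` — e.g. `ρ(d) = Π_{p∣d} p/(p−1)²`, the divisor form of the twin singular-series spectrum,
for which `G_ρ(h) = Σ_{d∣h} ρ(d) ≍ h/φ(h) ≍ 𝔖(h)+1` but `ρ(d)` is NOT `O(1/φ(d))`.  This series (`…Weighted{Defs,Tools,Main,}`)
proves the WEIGHTED statement `pairRigidityWeighted` by the same elementary argument.

This file: for `q = h₁P′` (coprime, every prime `≤ w₀` dividing `q`, `w₀ ≥ c₀`) and the aligned residue
`r ≡ 0 (h₁)`, `≡ 1 (P′)`: `|Φ_q(r) − F(h₁)| ≤ C·G_ρ(h₁)·(2c₀/w₀)` for squarefree-supported `x` with `|x_d| ≤ C ρ(d)`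
(hook `mainTermWeightedHook`); and the tail `|F(h₁h₂) − F(h₁)| ≤ C·G_ρ(h₁)(G_ρ(h₂) − 1)`, `G_ρ(h₂) ≤ e^{c₀k/w′}`.
(The `gcd`/CRT lemmas `gcd_eq_of_crt`, `gcd_dvd_iff_coprime`, `gcd_mul_eq_of_coprime` are imported from `…PairRigidityDecayMain`.)
-/

noncomputable section

open scoped BigOperators
open Finset Real

namespace Summit.Parity.GeneralizedHardyLittlewood.Cruxes.RelativeDimOne.RigidityC1

variable {ρ : ℕ → ℝ} {c₀ : ℝ}

/-! ### The main term (weighted) -/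

/-- THE MAIN-TERM BOUND.  Let `h₁ ≠ 0`, `P′` coprime to `h₁`, `q = h₁ P′`, and `r` with `h₁ ∣ r`,
`r ≡ 1 [MOD P′]`; assume every prime `p ≤ w₀` divides `q`.  For a spectrum `x` supported on squarefree
`d ∈ [1, Q]` with `|x_d| ≤ C/φ(d)`:
`|Φ_q(r) − F(h₁)| ≤ C · G(h₁) · (2/w₀)` — the difference is a sum over divisors `d = d₁ d₂` with
`d₁ ∣ h₁` and a `w₀`-ROUGH cofactor `d₂ > 1`, weighted `x_d / d₂`. -/
theorem abs_densAvg_sub_divSum_weighted_le (hρ : IsHLWeight ρ c₀) {Q w₀ h₁ P' r : ℕ} {C : ℝ} {x : ℕ → ℝ}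
    (hC : 0 ≤ C) (hw₀ : 1 ≤ w₀) (hcw : c₀ ≤ w₀) (hh₁ : h₁ ≠ 0) (hcop : Nat.Coprime h₁ P') (hr1 : h₁ ∣ r)
    (hr2 : r ≡ 1 [MOD P']) (hcover : ∀ p : ℕ, p.Prime → p ≤ w₀ → p ∣ h₁ * P')
    (hsupp : ∀ d, x d ≠ 0 → Squarefree d ∧ 1 ≤ d ∧ d ≤ Q) (hdec : ∀ d, |x d| ≤ C * ρ d) :
    |densAvg Q x (h₁ * P') r - divSum x h₁| ≤ C * wDivSum ρ h₁ * (2 * c₀ / w₀) := by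
  classical
  -- Step 1: rewrite `Φ` with the simplified weight `w(d) = [Coprime d P'] / (d / gcd(d,h₁))`.
  set wt : ℕ → ℝ := fun d => if Nat.Coprime d P' then (1 : ℝ) / ((d / Nat.gcd d h₁ : ℕ) : ℝ) else 0
    with hwt
  have hΦ : densAvg Q x (h₁ * P') r = ∑ d ∈ Icc 1 Q, x d * wt d := by
    unfold densAvg
    refine Finset.sum_congr rfl fun d hd => ?_
    have hd1 : 1 ≤ d := (Finset.mem_Icc.1 hd).1
    by_cases hc : Nat.Coprime d P'
    · have hdiv : Nat.gcd d (h₁ * P') ∣ r := (gcd_dvd_iff_coprime hcop hr1 hr2).2 hc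
      have hwt_d : wt d = 1 / ((d / Nat.gcd d h₁ : ℕ) : ℝ) := by simp [hwt, hc]
      rw [if_pos hdiv, mul_one, hwt_d, gcd_mul_eq_of_coprime hc]
      congr 1
      -- `gcd(d,h₁)/d = 1/(d/gcd(d,h₁))`
      have hg0 : 0 < Nat.gcd d h₁ := Nat.gcd_pos_of_pos_left _ hd1
      have hgd : Nat.gcd d h₁ ∣ d := Nat.gcd_dvd_left d h₁
      have hde : (Nat.gcd d h₁ : ℝ) * ((d / Nat.gcd d h₁ : ℕ) : ℝ) = d := by
        rw [← Nat.cast_mul, Nat.mul_div_cancel' hgd]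
      have hg0' : (0 : ℝ) < Nat.gcd d h₁ := by exact_mod_cast hg0
      have he0' : (0 : ℝ) < ((d / Nat.gcd d h₁ : ℕ) : ℝ) := by
        have : 0 < d / Nat.gcd d h₁ := Nat.div_pos (Nat.le_of_dvd hd1 hgd) hg0
        exact_mod_cast this
      rw [← hde]
      field_simp
    · have hndiv : ¬ Nat.gcd d (h₁ * P') ∣ r := fun h => hc ((gcd_dvd_iff_coprime hcop hr1 hr2).1 h)
      rw [if_neg hndiv, hwt]
      simp [if_neg hc]
  -- Step 2: `F(h₁) = Σ_{d ∈ Icc 1 Q, d ∣ h₁} x d`, and for `d ∣ h₁` the weight is `1`.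
  have hF : divSum x h₁ = ∑ d ∈ (Icc 1 Q).filter (· ∣ h₁), x d := by
    unfold divSum
    -- both are the sum of `x` over `{d ∣ h₁ : d ≤ Q}`, other divisors carry `x d = 0`
    have hsub : (Icc 1 Q).filter (· ∣ h₁) ⊆ h₁.divisors := by
      intro d hd
      rw [Finset.mem_filter] at hd
      exact Nat.mem_divisors.2 ⟨hd.2, hh₁⟩
    rw [← Finset.sum_subset hsub]
    intro d hd hnot
    by_contra hx
    have := hsupp d hx
    apply hnot
    rw [Finset.mem_filter, Finset.mem_Icc]
    exact ⟨⟨this.2.1, this.2.2⟩, Nat.dvd_of_mem_divisors hd⟩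
  have hwt_dvd : ∀ d, d ∣ h₁ → wt d = 1 := by
    intro d hd
    have hc : Nat.Coprime d P' := Nat.Coprime.coprime_dvd_left hd hcop
    rw [hwt]
    simp only [if_pos hc]
    rw [Nat.gcd_eq_left hd]
    have hd0 : 0 < d := Nat.pos_of_dvd_of_pos hd (Nat.pos_of_ne_zero hh₁)
    rw [Nat.div_self hd0]
    simp
  -- Step 3: the difference is the sum over `d ∤ h₁`.
  have hdiff : densAvg Q x (h₁ * P') r - divSum x h₁ =
      ∑ d ∈ (Icc 1 Q).filter (fun d => ¬ d ∣ h₁), x d * wt d := by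
    rw [hΦ, hF, ← Finset.sum_filter_add_sum_filter_not (Icc 1 Q) (· ∣ h₁)]
    have : ∑ d ∈ (Icc 1 Q).filter (· ∣ h₁), x d * wt d = ∑ d ∈ (Icc 1 Q).filter (· ∣ h₁), x d := by
      refine Finset.sum_congr rfl fun d hd => ?_
      rw [hwt_dvd d (Finset.mem_filter.1 hd).2, mul_one]
    rw [this]
    ring
  rw [hdiff]
  -- Step 4: bound termwise; only squarefree `d` coprime to `P'` contribute.
  set S := ((Icc 1 Q).filter (fun d => ¬ d ∣ h₁)).filter (fun d => Squarefree d ∧ Nat.Coprime d P')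
    with hS
  have hstep : |∑ d ∈ (Icc 1 Q).filter (fun d => ¬ d ∣ h₁), x d * wt d| ≤
      ∑ d ∈ S, C * ρ d * ((1 : ℝ) / ((d / Nat.gcd d h₁ : ℕ) : ℝ)) := by
    refine (Finset.abs_sum_le_sum_abs _ _).trans ?_
    rw [show (∑ d ∈ S, C * ρ d * ((1 : ℝ) / ((d / Nat.gcd d h₁ : ℕ) : ℝ))) =
        ∑ d ∈ (Icc 1 Q).filter (fun d => ¬ d ∣ h₁),
          (if Squarefree d ∧ Nat.Coprime d P' then C * ρ d * ((1 : ℝ) / ((d / Nat.gcd d h₁ : ℕ) : ℝ))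
            else 0) from by rw [hS, Finset.sum_filter]]
    refine Finset.sum_le_sum fun d hd => ?_
    by_cases hgood : Squarefree d ∧ Nat.Coprime d P'
    · rw [if_pos hgood, hwt]
      simp only [if_pos hgood.2]
      rw [abs_mul, abs_of_nonneg (by positivity : (0 : ℝ) ≤ 1 / ((d / Nat.gcd d h₁ : ℕ) : ℝ))]
      exact mul_le_mul_of_nonneg_right (hdec d) (by positivity)
    · rw [if_neg hgood]
      -- then `x d * wt d = 0`
      have : x d * wt d = 0 := by
        by_cases hc : Nat.Coprime d P'
        · have hx : x d = 0 := by
            by_contra hx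
            exact hgood ⟨(hsupp d hx).1, hc⟩
          rw [hx, zero_mul]
        · rw [hwt]
          simp [if_neg hc]
      rw [this, abs_zero]
  refine hstep.trans ?_
  -- Step 5: reindex `d ↦ (gcd(d,h₁), d / gcd(d,h₁))` into `h₁.divisors × (rough divisors ≠ 1)`.
  set T := (roughPrimorial w₀ Q).divisors.erase 1 with hT
  set ι : ℕ → ℕ × ℕ := fun d => (Nat.gcd d h₁, d / Nat.gcd d h₁) with hι
  have hι_inj : Set.InjOn ι S := by
    intro a _ b _ hab
    simp only [hι, Prod.mk.injEq] at hab
    have ha : a = Nat.gcd a h₁ * (a / Nat.gcd a h₁) :=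
      (Nat.mul_div_cancel' (Nat.gcd_dvd_left a h₁)).symm
    have hb : b = Nat.gcd b h₁ * (b / Nat.gcd b h₁) :=
      (Nat.mul_div_cancel' (Nat.gcd_dvd_left b h₁)).symm
    calc a = Nat.gcd a h₁ * (a / Nat.gcd a h₁) := ha
      _ = Nat.gcd b h₁ * (b / Nat.gcd b h₁) := by rw [hab.2, hab.1]
      _ = b := hb.symm
  have hι_maps : ∀ d ∈ S, ι d ∈ h₁.divisors ×ˢ T := by
    intro d hd
    rw [hS, Finset.mem_filter, Finset.mem_filter, Finset.mem_Icc] at hd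
    obtain ⟨⟨⟨hd1, hdQ⟩, hndvd⟩, hsq, hcP⟩ := hd
    set d₁ := Nat.gcd d h₁ with hd₁
    set d₂ := d / Nat.gcd d h₁ with hd₂
    have hdd : d = d₁ * d₂ := (Nat.mul_div_cancel' (Nat.gcd_dvd_left d h₁)).symm
    have hsq2 : Squarefree (d₁ * d₂) := hdd ▸ hsq
    have hcop12 : Nat.Coprime d₁ d₂ := Nat.coprime_of_squarefree_mul hsq2
    have hsqd₂ : Squarefree d₂ := hsq2.of_mul_right
    have hmem1 : d₁ ∈ h₁.divisors := Nat.mem_divisors.2 ⟨Nat.gcd_dvd_right d h₁, hh₁⟩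
    have hmem2 : d₂ ∈ T := by
      rw [hT, Finset.mem_erase]
      constructor
      · -- `d₂ ≠ 1` since `d ∤ h₁`
        intro h1
        apply hndvd
        rw [hdd, h1, mul_one]
        exact Nat.gcd_dvd_right d h₁
      · rw [Nat.mem_divisors]
        refine ⟨?_, (roughPrimorial_pos w₀ Q).ne'⟩
        -- `d₂ = Π primeFactors d₂` and every prime factor lies in `(w₀, Q]`
        rw [← Nat.prod_primeFactors_of_squarefree hsqd₂]
        unfold roughPrimorial
        refine Finset.prod_dvd_prod_of_subset _ _ _ fun p hp => ?_
        have hpp : p.Prime := Nat.prime_of_mem_primeFactors hp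
        have hpd₂ : p ∣ d₂ := Nat.dvd_of_mem_primeFactors hp
        have hpd : p ∣ d := hpd₂.trans (hdd ▸ Dvd.intro_left _ rfl)
        rw [Finset.mem_filter, Finset.mem_Ioc]
        refine ⟨⟨?_, ?_⟩, hpp⟩
        · -- `p > w₀`: otherwise `p ∣ h₁ P'`, so `p ∣ h₁` (then `p ∣ d₁`, contradicting coprimality with `d₂`) or `p ∣ P'`
          by_contra hle
          push Not at hle
          have hpq : p ∣ h₁ * P' := hcover p hpp (by omega)
          rcases (Nat.Prime.dvd_mul hpp).1 hpq with hph | hpP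
          · have hpd₁ : p ∣ d₁ := Nat.dvd_gcd hpd hph
            have : p ∣ Nat.gcd d₁ d₂ := Nat.dvd_gcd hpd₁ hpd₂
            rw [Nat.Coprime.gcd_eq_one hcop12] at this
            exact hpp.one_lt.ne' (Nat.dvd_one.1 this)
          · have : p ∣ Nat.gcd d P' := Nat.dvd_gcd hpd hpP
            rw [Nat.Coprime.gcd_eq_one hcP] at this
            exact hpp.one_lt.ne' (Nat.dvd_one.1 this)
        · exact (Nat.le_of_dvd (by omega) hpd).trans hdQ
    exact Finset.mem_product.2 ⟨hmem1, hmem2⟩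
  -- the summand as a function of `ι d`
  have hterm : ∀ d ∈ S, C * ρ d * ((1 : ℝ) / ((d / Nat.gcd d h₁ : ℕ) : ℝ)) =
      C * (ρ (ι d).1 * (ρ (ι d).2 / ((ι d).2 : ℝ))) := by
    intro d hd
    rw [hS, Finset.mem_filter, Finset.mem_filter, Finset.mem_Icc] at hd
    obtain ⟨⟨⟨_, _⟩, _⟩, hsq, _⟩ := hd
    show C * ρ d * ((1 : ℝ) / ((d / Nat.gcd d h₁ : ℕ) : ℝ)) =
      C * (ρ (Nat.gcd d h₁) * (ρ (d / Nat.gcd d h₁) / ((d / Nat.gcd d h₁ : ℕ) : ℝ)))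
    have hdd : d = Nat.gcd d h₁ * (d / Nat.gcd d h₁) :=
      (Nat.mul_div_cancel' (Nat.gcd_dvd_left d h₁)).symm
    have hsq2 : Squarefree (Nat.gcd d h₁ * (d / Nat.gcd d h₁)) := hdd ▸ hsq
    have hcop12 : Nat.Coprime (Nat.gcd d h₁) (d / Nat.gcd d h₁) := Nat.coprime_of_squarefree_mul hsq2
    have hρd : ρ d = ρ (Nat.gcd d h₁) * ρ (d / Nat.gcd d h₁) := by
      conv_lhs => rw [hdd]
      exact hρ.map_mul _ _ hcop12
    rw [hρd]
    ring
  calc ∑ d ∈ S, C * ρ d * ((1 : ℝ) / ((d / Nat.gcd d h₁ : ℕ) : ℝ))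
      = ∑ d ∈ S, C * (ρ (ι d).1 * (ρ (ι d).2 / ((ι d).2 : ℝ))) := Finset.sum_congr rfl hterm
    _ = C * ∑ d ∈ S, (ρ (ι d).1 * (ρ (ι d).2 / ((ι d).2 : ℝ))) := by rw [Finset.mul_sum]
    _ = C * ∑ y ∈ S.image ι, (ρ y.1 * (ρ y.2 / (y.2 : ℝ))) := by
          rw [Finset.sum_image hι_inj]
    _ ≤ C * ∑ y ∈ h₁.divisors ×ˢ T, (ρ y.1 * (ρ y.2 / (y.2 : ℝ))) := by
          refine mul_le_mul_of_nonneg_left ?_ hC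
          refine Finset.sum_le_sum_of_subset_of_nonneg ?_ fun y _ _ =>
            mul_nonneg (hρ.nonneg _) (div_nonneg (hρ.nonneg _) (Nat.cast_nonneg _))
          intro y hy
          rw [Finset.mem_image] at hy
          obtain ⟨d, hd, rfl⟩ := hy
          exact hι_maps d hd
    _ = C * ((∑ d₁ ∈ h₁.divisors, ρ d₁) * ∑ d₂ ∈ T, ρ d₂ / (d₂ : ℝ)) := by
          rw [Finset.sum_product, Finset.sum_mul_sum]
    _ ≤ C * (wDivSum ρ h₁ * (2 * c₀ / w₀)) := by
          refine mul_le_mul_of_nonneg_left ?_ hC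
          exact mul_le_mul_of_nonneg_left (sum_rough_divisors_weighted_le hρ hw₀ hcw Q) (wDivSum_nonneg hρ h₁)
    _ = C * wDivSum ρ h₁ * (2 * c₀ / w₀) := by ring


/-! ### The tail (weighted) -/

/-- Splitting a product of distinct primes at `w′`: with `h₁ = Π{p ∈ P : p ≤ w′}`,
`h₂ = Π{p ∈ P : p > w′}`, one has `|F(h₁h₂) − F(h₁)| ≤ C·G(h₁)·(G(h₂) − 1)` for any spectrum with
`|x_d| ≤ C/φ(d)`. -/
theorem abs_divSum_prod_sub_weighted_le (hρ : IsHLWeight ρ c₀) {C : ℝ} {x : ℕ → ℝ}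
    (hdec : ∀ d, |x d| ≤ C * ρ d) (P : Finset ℕ) (hP : ∀ p ∈ P, p.Prime) (w' : ℕ) :
    |divSum x ((∏ p ∈ P.filter (· ≤ w'), p) * ∏ p ∈ P.filter (fun p => ¬ p ≤ w'), p) -
        divSum x (∏ p ∈ P.filter (· ≤ w'), p)| ≤
      C * wDivSum ρ (∏ p ∈ P.filter (· ≤ w'), p) *
        (wDivSum ρ (∏ p ∈ P.filter (fun p => ¬ p ≤ w'), p) - 1) := by
  classical
  set h₁ := ∏ p ∈ P.filter (· ≤ w'), p with hh₁
  set h₂ := ∏ p ∈ P.filter (fun p => ¬ p ≤ w'), p with hh₂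
  have hcop : Nat.Coprime h₁ h₂ := by
    rw [hh₁, hh₂]
    refine Nat.Coprime.prod_left fun p hp => Nat.Coprime.prod_right fun q hq => ?_
    have hp' := Finset.mem_filter.1 hp
    have hq' := Finset.mem_filter.1 hq
    have hne : p ≠ q := fun h => hq'.2 (h ▸ hp'.2)
    exact (Nat.coprime_primes (hP p hp'.1) (hP q hq'.1)).2 hne
  have hh₁0 : h₁ ≠ 0 := Finset.prod_ne_zero_iff.2 fun p hp => (hP p (Finset.mem_filter.1 hp).1).ne_zero
  have hh₂0 : h₂ ≠ 0 := Finset.prod_ne_zero_iff.2 fun p hp => (hP p (Finset.mem_filter.1 hp).1).ne_zero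
  have h1mem : (1 : ℕ) ∈ h₂.divisors := Nat.one_mem_divisors.2 hh₂0
  -- expand `F(h₁ h₂)` and split off `b = 1`
  have hexp : divSum x (h₁ * h₂) =
      divSum x h₁ + ∑ a ∈ h₁.divisors, ∑ b ∈ h₂.divisors.erase 1, x (a * b) := by
    unfold divSum
    rw [Literature.NumberTheory.Sieve.sum_divisors_mul_of_coprime hcop]
    rw [← Finset.sum_add_distrib]
    refine Finset.sum_congr rfl fun a _ => ?_
    rw [← Finset.add_sum_erase _ _ h1mem, mul_one]
  rw [hexp, add_sub_cancel_left]
  -- bound termwise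
  have hG₂ : wDivSum ρ h₂ - 1 = ∑ b ∈ h₂.divisors.erase 1, ρ b := by
    unfold wDivSum
    rw [← Finset.add_sum_erase _ _ h1mem, hρ.map_one]
    simp
  calc |∑ a ∈ h₁.divisors, ∑ b ∈ h₂.divisors.erase 1, x (a * b)|
      ≤ ∑ a ∈ h₁.divisors, |∑ b ∈ h₂.divisors.erase 1, x (a * b)| := Finset.abs_sum_le_sum_abs _ _
    _ ≤ ∑ a ∈ h₁.divisors, ∑ b ∈ h₂.divisors.erase 1, |x (a * b)| :=
        Finset.sum_le_sum fun a _ => Finset.abs_sum_le_sum_abs _ _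
    _ ≤ ∑ a ∈ h₁.divisors, ∑ b ∈ h₂.divisors.erase 1, C * (ρ a * ρ b) := by
        refine Finset.sum_le_sum fun a ha => Finset.sum_le_sum fun b hb => ?_
        have hadvd : a ∣ h₁ := Nat.dvd_of_mem_divisors ha
        have hbdvd : b ∣ h₂ := Nat.dvd_of_mem_divisors (Finset.mem_of_mem_erase hb)
        have hab : Nat.Coprime a b :=
          Nat.Coprime.coprime_dvd_left hadvd (Nat.Coprime.coprime_dvd_right hbdvd hcop)
        refine (hdec (a * b)).trans (le_of_eq ?_)
        rw [hρ.map_mul a b hab]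
    _ = C * wDivSum ρ h₁ * (wDivSum ρ h₂ - 1) := by
        rw [hG₂]
        unfold wDivSum
        rw [mul_assoc, Finset.sum_mul_sum, Finset.mul_sum]
        refine Finset.sum_congr rfl fun a _ => ?_
        rw [Finset.mul_sum]

/-- For primes all exceeding `w′ ≥ 1`: `G_ρ(Π P₂) ≤ exp(c₀ #P₂ / w′)`. -/
theorem wDivSum_prod_large_primes_le (hρ : IsHLWeight ρ c₀) (P₂ : Finset ℕ) (hP : ∀ p ∈ P₂, p.Prime)
    {w' : ℕ} (hw' : 1 ≤ w') (hlarge : ∀ p ∈ P₂, w' < p) :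
    wDivSum ρ (∏ p ∈ P₂, p) ≤ Real.exp (c₀ * (P₂.card : ℝ) / w') := by
  rw [wDivSum_prod_primes hρ P₂ hP]
  have hw0 : (0 : ℝ) < w' := by exact_mod_cast hw'
  have hc₀ : 0 ≤ c₀ := le_trans zero_le_one hρ.one_le
  calc ∏ p ∈ P₂, (1 + ρ p) ≤ ∏ _p ∈ P₂, Real.exp (c₀ / (w' : ℝ)) := by
        refine Finset.prod_le_prod (fun p hp => ?_) (fun p hp => ?_)
        · have := hρ.nonneg p
          linarith
        · have hp1 : (w' : ℝ) ≤ (p : ℝ) - 1 := by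
            have : w' + 1 ≤ p := hlarge p hp
            have : ((w' + 1 : ℕ) : ℝ) ≤ p := by exact_mod_cast this
            push_cast at this
            linarith
          have h1 : ρ p ≤ c₀ / (w' : ℝ) :=
            (hρ.prime_le p (hP p hp)).trans (div_le_div_of_nonneg_left hc₀ hw0 hp1)
          have h2 := Real.add_one_le_exp (c₀ / (w' : ℝ))
          linarith
    _ = Real.exp (c₀ * (P₂.card : ℝ) / w') := by
        rw [Finset.prod_const, ← Real.exp_nat_mul]
        congr 1
        ring



/-- Registered hook (stmt-Parity-14113, seat c1): the weighted main-term bound, `∀`-form of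
`abs_densAvg_sub_divSum_weighted_le`. -/
theorem mainTermWeightedHook : ∀ (ρ : ℕ → ℝ) (c₀ : ℝ) (Q w₀ h₁ P' r : ℕ) (C : ℝ) (x : ℕ → ℝ),
    IsHLWeight ρ c₀ → 0 ≤ C → 1 ≤ w₀ → c₀ ≤ w₀ → h₁ ≠ 0 → Nat.Coprime h₁ P' → h₁ ∣ r → r ≡ 1 [MOD P'] →
    (∀ p : ℕ, p.Prime → p ≤ w₀ → p ∣ h₁ * P') →
    (∀ d, x d ≠ 0 → Squarefree d ∧ 1 ≤ d ∧ d ≤ Q) → (∀ d, |x d| ≤ C * ρ d) →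
    |densAvg Q x (h₁ * P') r - divSum x h₁| ≤ C * wDivSum ρ h₁ * (2 * c₀ / w₀) :=
  fun _ _ _ _ _ _ _ _ _ hρ hC hw₀ hcw hh₁ hcop hr1 hr2 hcover hsupp hdec =>
    abs_densAvg_sub_divSum_weighted_le hρ hC hw₀ hcw hh₁ hcop hr1 hr2 hcover hsupp hdec

end Summit.Parity.GeneralizedHardyLittlewood.Cruxes.RelativeDimOne.RigidityC1
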